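import Summits.QuantumFields.YangMills.Theorems.BalabanUVNodesN24Stub1VWShareK1AxV113
import Summits.QuantumFields.YangMills.Theorems.BalabanUVNodesN24Stub1VWShareK1AxV11AERow
import Summits.QuantumFields.YangMills.Theorems.BalabanUVNodesN13GuardedUVRowAtRevisionOfAERowsAtRecord13Ax

/-!
# BalabanUVNodes ∕ K1ᴬ LINE 2′ v11.3 — N24's SHARE OF `stub_nodes13PWSVW`, GUARDED-ROW ∕ ENGINE-CURRENCY EDITION, RE-KEYED TO THE (R-a′) PER-RUN MEMORY GUARD (★★★ director-ym №663 (4)(e);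
# ✦ plan g104 v11.3 install 4d5a20924a86ea9d): the (T) file ✓p813787 `…N24Stub1VWShareK1AxV11AERow` with EXACTLY the `hW ∕ hW0 ∕ h12` split moved from «`λW.kSel P < P.K`» to
# «`λW.kSel P < P.K` AND `B15Claim189PinsOfHistory.N0OfRecord₁₃Ax θ.toStage13Params P (λW.kSel P + 1) ≤ λW.kSel P + 1`», the rung-1ⱽᵂ text read at the v11.3 mirror `K1AxV113Defs.NodesAtSomeRecord13PWSVW`

TRACK A (YM-PLAN §2d), node N24 (binder B2, COMPOSITE), seat `pub-ymgap-dag-n24-c` g27 (the -a hand on LINE 2′), `--kind proof --supports stmt-QuantumFields-27239 --as helper` (count-neutral).  PARENT OF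
RECORD: ✓p813787 (g24) — N13's bill is EXACTLY the engines' row (✓p811182 §2 `h13` ∕ ✓p810415 §2Ax), transferred to a revision WITH ITS `SLaw` GUARD by ✓`…N13GuardedUVRowAtRevisionOfAERowsAtRecord13Ax`;
the class ∕ socket lemmas are (Q) ✓p813442's BY NAME.  DECLARED EDITS (generator `gen_e.py T` over the tree bytes, every edit counted; the same five as the sibling `…N24Stub1VWShareK1AxV113`):
(M1) `hW : ∀ P, λW.kSel P < P.K → N₀ ≤ kSel+1 → W₀ P = WOfRecord₁₃Ax …`; (M2) `hW0 : ∀ P, ¬ (λW.kSel P < P.K ∧ N₀ ≤ kSel+1) → B15Leaf (W₀ P)` (free carrier with a true [IV] leaf at the runs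
OUTSIDE the pin's scope: K = 0 AND the memory-unfit runs); (M3) `h12 : … → Step.InInterval … → N₀ ≤ kSel+1 → B15Leaf (WOfRecord₁₃Ax … λW P)` (pointed, ∃-form, family form) = dag-n12-d's
MEMORY-GUARDED bill body (G4 `…N12BillH12ForStub1VWK1AxV11OfJunctionRowsMemGuarded`) = the engine (W′)'s `h12F` body; (M4) the [IV]-pin conjunct of rung 1ⱽᵂ carries the guard (kit :519–521); (M5)
§3's free carrier `W₀ P := if (λW.kSel P < P.K ∧ N₀ ≤ kSel+1) then WOfRecord₁₃Ax … else ⟨junk, B15Leaf⟩`.  Theorem names = the parent's, in the sibling namespace `…N24Stub1VWShareK1AxV113AERow`.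

WHAT IS HERE (theorems only; 0 `def`, 0 `sorry`, standard axioms): §1 `N24_nodesW_at_recordSV_Ax_pointed_of_uvRowV` (the thirteen nodes, window-guarded, N13 ← the guarded row on `v.ρ`, N12 on
the windowed MEMORY-FITTING genuine runs); §2 `N24_rung1VW_bodyAt_pointed_of_uvRowV` (rung 1ⱽᵂ v11.3's body at the witness); §3 ★★★ `N24_rung1VW_bodyAt_of_bills_at_aeRow` (bills AT θ ⟹ `v`, `w`
with prescribed `βup` and the v11.3 body); §4 ★★★★ `stub1TextVW_of_bills_atWitnessFamily_aeRow : … → ∀ F, Inhabited13 F → K1AxV113Defs.NodesAtSomeRecord13PWSVW F` (bills at a witness family).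
WHICH CHILD BLOCKS `stub_nodes13PWSVW` = §4's hypothesis list, BY NAME: N05 `h05` · N06 `h06` · N07 `h07` · N08 `h08` · N09 `h09`+`h09T` · N10 `h10` · N11 `h11` · 𝐑 `hR` · N12 `h12` (MEMORY-GUARDED,
live-selector members) · N13 `h13` (engine currency).

HONEST COST (★★★ №663 (1), verbatim): «N12 ([IV] basic step) is pinned at every windowed run WHOSE MEMORY FITS; at shorter runs the `rBasicStep` leaf of `Nodes` is unpinned because print applies
no 𝐑 there» — a GAP-STATED corner, named and sourced ([IV] p.177 (ii), p.179 «N > N₀», p.200; desk ME #57 LOCATED-NEGATIVE); here it is (M2)'s free carrier.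
HONEST SCOPE ∕ A6.  Implications only; every bill is a DISPLAYED hypothesis, inhabited at NO θ here; nothing of Bałaban asserted; `stub_nodes13PWSVW` NOT closed; K1ᴬ OPEN (0∕6); N24
COMPOSITE — no discharge, no count claim (discharged 8∕27 · K 1∕4 unmoved).  One finite 𝕋⁴ programme at fixed ε — NOT continuum ∕ ℝ⁴ ∕ OS; NOT the Yang–Mills mass gap (Clay).  No `def`, no
`instance`, no `sorry`.  References (bookkeeping only): [Balaban1989LargeFieldII] Thm 1 p.355, (0.1) pp.355–356; [Balaban1988Convergent] (2.18) p.257, Cor. 3 (2.50) p.264; [Balaban1989LargeFieldI]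
(0.2)–(0.6) p.176, p.177 (ii), p.179, Prop. 1 p.194, p.200; [Balaban1987RG1] (0.17)–(0.20) pp.255–256, Thm 1 p.259, (2.9) p.266; [Balaban1985RegularSpaces] Thm 8 p.101; [Balaban1985UV3] Thm 1 p.257.
-/

noncomputable section

open scoped Matrix.Norms.L2Operator BigOperators
open MeasureTheory

namespace Summit.QuantumFields.YangMills.BalabanUVNodes.N24Stub1VWShareK1AxV113AERow

open Literature.MathematicalPhysics.QuantumFieldTheory.Balaban1983to89
open Literature.MathematicalPhysics.QuantumFieldTheory.Balaban1983to89.Node00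
open DagBinding T4Continuum T4DatumAssembly FlowStepRuns AveragingRT
open Summit.QuantumFields.YangMills.BalabanUVNodes.N13NodeAtRevisedRecordWorldAtRecord13SepCoPHVAx (leavesP_revision₁₃Ax_eq_update)
open Summit.QuantumFields.YangMills.BalabanUVNodes.N12PinAtRecordBundleForK1AxRung1VW (smallCouplings_leavesP_iff_stepInInterval_gOfRecord₁₃Ax)
open Summit.QuantumFields.YangMills.BalabanUVNodes.N12AtRecord12Pointed (exists_printedCarriers15_b15Leaf)
open Summit.QuantumFields.YangMills.Theorems.K1AxV11Defs (Inhabited13 RecordSV)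
open Summit.QuantumFields.YangMills.Theorems.K1AxV113Defs (NodesAtSomeRecord13PWSVW)
open Summit.QuantumFields.YangMills.BalabanUVNodes.N24Stub1VWShareK1AxV11 (nodes_update_uvBounds_of_nodes11_b15_b16 N24_recordSV_Ax_of_upS_rebindX_pinB10Y₀ZW₀ socket05S_chain_pinX3H_iff_Ax socket09_XPinned₁₃H_iff socket10_XPinned₁₃H_iff)
open Summit.QuantumFields.YangMills.BalabanUVNodes.N13GuardedUVRowAtRevisionOfAERowsAtRecord13Ax (exists_revision₁₃Ax_guardedUVRowV_of_row0_of_aeRowSucc b16_main_at_recordVAx_of_rOperation_of_guardedUVRowV)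

/-! ## §1. ★★ The thirteen nodes, window-guarded, at the S-bound revised world — N13 from the GUARDED row -/

section General
variable {F : T4Family} {N : ℕ} [NeZero N]

/-- **★★ N24 · THE THIRTEEN DAG NODES, WINDOW-GUARDED, AT A WORLD S-BOUND TO THE χ⋆-FOUR-PIN CHAIN OF `θ.rebindX X′` AND BOUND TO THE REVISED RE-CENTRED DATUM** (`χ⋆ := chiβOfRecord₁₃Ax θ`; `X′`,
`Y₀`, `ζ`, `W₀`, `λW` FREE): **N05 ← the SURVIVING `b8` leaf of the S-binding** `h05S` (displayed at the chain; at dag-n05-d's H-pin it is `B8LeafOfRecordSubBH θ₃ λ₈`); N06 `h06 : B9LeafX Y₀`;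
N07 `B11Leaf (Z11OfRecord ζ)`; N08 `PrintedUV3V N θ.L`; N09 Lemma 4 at `X′ P` + Theorem-3 member `h09T` (world-keyed, at the record-rebound twin); N10 the [B13] socket at `X′ P`; N11 (S1ᵀ) `h11`
(world-keyed, at the twin); the 𝐑-reading `hR`; **N12 ON THE WINDOW RUNS at the bundle of record** `h12` where the W-pin carries it (`hW`; off the pinned runs `W₀` carries any true leaf, `hW0`);
**N13 ← the `SLaw`-GUARDED pointwise (2.50) row on the revision's densities `v.ρ`** `hUVV` with the world's letters (`w.γ ≤ γ₁₃`; Theorem-1-free, via `…N13GuardedUVRowAtRevisionOfAERowsAtRecord13Ax` §3).  N01–N11 + 𝐑 at the twin by this seat's χ glue (✓p810328), transported by `leavesP_revision₁₃Ax_eq_update`; N12 by the W-pin's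
`rBasicStep` face; N13 by the guarded-row knit.  The GUARDED-ROW EDITION of ✓p813442 §2 (same proof, last line swapped).  CONDITIONAL on every displayed hypothesis; nothing of Bałaban asserted.
[cite: Balaban1989LargeFieldII, Thm 1 p.355, (0.1) pp.355–356, p.387, p.391; Balaban1985RegularSpaces, Thm 8 (1.146) p.101 (surviving form); Balaban1985BackgroundPropagators, Thm 3.1 p.397; Balaban1985Variational, Thm 1 p.279; Balaban1985UV3, Thm 1 p.257, Thm 2 p.272; Balaban1987RG1, Lemma 4 p.280, Thm 1 p.259, (2.9) p.266; Balaban1988RG2Cluster, Lemmas 1–3 pp.9–20; Balaban1988Convergent, Thm 2 p.263, Cor. 3 (2.50) p.264; Balaban1989LargeFieldI, (0.2)–(0.6) p.176, Prop. 1 p.194 (bookkeeping over the cell's DAG)] -/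
theorem N24_nodesW_at_recordSV_Ax_pointed_of_uvRowV (θ : Stage13HParams F N) (h : θ.Provisos₁₃SepCoPHAx F N) (hθ : θ.Admissible F N) (v : Revision₁₃Ax F N θ h)
    (X' : B12.RunParams → PrintedCarriersR) (Y₀ : PrintedCarriers9X) (ζ : ResidZ F N) (W₀ : B12.RunParams → PrintedCarriers15) (lamW : ResidW F N) (w : WorldP)
    (hC : w.C = (datumOfRecord₁₃SepCoPHVAx F N θ h v).C) (hγ : 0 < w.γ ∧ w.γ ≤ θ.γ) (hL : w.L = (θ.L : ℝ))
    (hup : ∀ P, w.up P = upOfRecord₅CS F N ((((((θ.rebindX F N X').toStage5₁₃CoPHChi F N (chiβOfRecord₁₃Ax F N θ.toStage13Params)).pinB10 F N).pinY F N Y₀).pinZ F N (Z11OfRecord F N ζ)).pinW F N W₀) P)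
    (h05S : ∀ P : B12.RunParams,
      (upOfRecord₅CS F N ((((((θ.rebindX F N X').toStage5₁₃CoPHChi F N (chiβOfRecord₁₃Ax F N θ.toStage13Params)).pinB10 F N).pinY F N Y₀).pinZ F N (Z11OfRecord F N ζ)).pinW F N W₀) P).b8)
    (h06 : B9LeafX Y₀)
    (h07 : B11Leaf (Z11OfRecord F N ζ))
    (h08 : PrintedUV3V N θ.L)
    (h09 : ∀ P : B12.RunParams, B12Sec2to5.Lemma4Printed (X' P).F12 (X' P).c12)
    (h09T : ∀ P : B12.RunParams, (leavesP { w with C := (datumOfRecord₁₃SepCoPHAx F N θ h).C } P).smallCouplings →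
      (leavesP { w with C := (datumOfRecord₁₃SepCoPHAx F N θ h).C } P).smallFieldInductive)
    (h10 : ∀ P : B12.RunParams, B9LeafX Y₀ →
      (B10.Thm1PrintedCompact (((((((θ.rebindX F N X').toStage5₁₃CoPHChi F N (chiβOfRecord₁₃Ax F N θ.toStage13Params)).pinB10 F N).pinY F N Y₀).pinZ F N (Z11OfRecord F N ζ)).pinW F N W₀).res.X P).runs10 ∧
          B10.Thm2Printed (((((((θ.rebindX F N X').toStage5₁₃CoPHChi F N (chiβOfRecord₁₃Ax F N θ.toStage13Params)).pinB10 F N).pinY F N Y₀).pinZ F N (Z11OfRecord F N ζ)).pinW F N W₀).res.X P).runs10) →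
        B11Leaf (Z11OfRecord F N ζ) → B12Sec2to5.Lemma4Printed (X' P).F12 (X' P).c12 →
          B13.Lemma1Printed (X' P).S13 (X' P).c13 ∧ B13.Lemma2Printed (X' P).S13 (X' P).c13 ∧ B13.Lemma3Printed (X' P).S13 (X' P).c13)
    (h11 : ∀ P : B12.RunParams, (leavesP { w with C := (datumOfRecord₁₃SepCoPHAx F N θ h).C } P).b7 → (leavesP { w with C := (datumOfRecord₁₃SepCoPHAx F N θ h).C } P).b8 →
      (leavesP { w with C := (datumOfRecord₁₃SepCoPHAx F N θ h).C } P).b9 → (leavesP { w with C := (datumOfRecord₁₃SepCoPHAx F N θ h).C } P).b10 →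
      (leavesP { w with C := (datumOfRecord₁₃SepCoPHAx F N θ h).C } P).b11 → (leavesP { w with C := (datumOfRecord₁₃SepCoPHAx F N θ h).C } P).smallCouplings →
      (leavesP { w with C := (datumOfRecord₁₃SepCoPHAx F N θ h).C } P).smallFieldInductive → (leavesP { w with C := (datumOfRecord₁₃SepCoPHAx F N θ h).C } P).flowControl →
        ∀ k, k < P.K → SLaw₁₃CoPHChi F N θ (chiβOfRecord₁₃Ax F N θ.toStage13Params) P k → TLaw₁₃CoPHChi F N θ (chiβOfRecord₁₃Ax F N θ.toStage13Params) P k)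
    (hR : ∀ (P : B12.RunParams) (k : ℕ), k < P.K → TLaw₁₃CoPHChi F N θ (chiβOfRecord₁₃Ax F N θ.toStage13Params) P k → SLaw₁₃CoPHChi F N θ (chiβOfRecord₁₃Ax F N θ.toStage13Params) P (k + 1))
    (hW : ∀ P : B12.RunParams, lamW.kSel P < P.K → B15Claim189PinsOfHistory.N0OfRecord₁₃Ax θ.toStage13Params P (lamW.kSel P + 1) ≤ lamW.kSel P + 1 → W₀ P = WOfRecord₁₃Ax F N θ.toStage13Params lamW P)
    (hW0 : ∀ P : B12.RunParams, ¬ (lamW.kSel P < P.K ∧ B15Claim189PinsOfHistory.N0OfRecord₁₃Ax θ.toStage13Params P (lamW.kSel P + 1) ≤ lamW.kSel P + 1) → B15Leaf (W₀ P))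
    (h12 : ∀ P : B12.RunParams, lamW.kSel P < P.K → Step.InInterval w.γ P.K (gOfRecord₁₃Ax F N θ.toStage13Params P) → B15Claim189PinsOfHistory.N0OfRecord₁₃Ax θ.toStage13Params P (lamW.kSel P + 1) ≤ lamW.kSel P + 1 → B15Leaf (WOfRecord₁₃Ax F N θ.toStage13Params lamW P))
    {γ₁₃ : ℝ} (hγ₁₃ : w.γ ≤ γ₁₃)
    (hUVV : ∀ P : B12.RunParams, (genFlow (betaOfRecord₁₃Ax F N θ.toStage13Params) P.g0).InInterval γ₁₃ P.K → ∀ k, k ≤ P.K →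
      SLaw₁₃CoPHChi F N θ (chiβOfRecord₁₃Ax F N θ.toStage13Params) P k → ∀ U : GaugeField (F.P P.K) k (SU N),
        chiβOfRecord₁₃Ax F N θ.toStage13Params P.K (gOfRecord₁₃Ax F N θ.toStage13Params P) k U *
              Real.exp (-(1 / (gOfRecord₁₃Ax F N θ.toStage13Params P k) ^ 2 * wilsonBGOfRecord F N θ.εbg P k U)
                - w.em (gOfRecord₁₃Ax F N θ.toStage13Params P k) * (Fintype.card (Site (F.P P.K) k) : ℝ)) ≤ v.ρ P k U ∧
          v.ρ P k U ≤ Real.exp (w.ep (gOfRecord₁₃Ax F N θ.toStage13Params P k) * (Fintype.card (Site (F.P P.K) k) : ℝ))) :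
    ∀ P : B12.RunParams, (leavesP w P).smallCouplings → Nodes (leavesP w P) := by
  intro P hsc
  -- the record-rebound twin world: same letters, same `up`, construction re-bound to the re-centred record datum
  have hnodes₀ := N24_nodes11_rOperation₁₃SepCoPHChi_rebindX_withB8_pinB10Y₀ZW₀_pointed_chi θ (chiβOfRecord₁₃Ax F N θ.toStage13Params) h hθ X' Y₀ ζ W₀
    (fun P => (upOfRecord₅CS F N ((((((θ.rebindX F N X').toStage5₁₃CoPHChi F N (chiβOfRecord₁₃Ax F N θ.toStage13Params)).pinB10 F N).pinY F N Y₀).pinZ F N (Z11OfRecord F N ζ)).pinW F N W₀) P).b8)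
    { w with C := (datumOfRecord₁₃SepCoPHAx F N θ h).C } rfl hγ hL (fun P => by rw [show ({ w with C := (datumOfRecord₁₃SepCoPHAx F N θ h).C } : WorldP).up P = w.up P from rfl, hup P]; rfl)
    h05S h06 h07 h08 h09 h09T h10 h11 hR P
  -- N12 at the W-pinned world: the `rBasicStep` leaf IS `B15Leaf (W₀ P)`, supplied on the pinned window runs by N12's leaf, elsewhere by `hW0`
  have hrb : (w.up P).rBasicStep ↔ B15Leaf (W₀ P) := by
    rw [hup P]
    exact upOfRecord₅C_pinW_rBasicStep_iff F N _ W₀ P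
  have h15leaf : (w.up P).rBasicStep := by
    rw [hrb]
    by_cases hk : lamW.kSel P < P.K ∧ B15Claim189PinsOfHistory.N0OfRecord₁₃Ax θ.toStage13Params P (lamW.kSel P + 1) ≤ lamW.kSel P + 1
    · rw [hW P hk.1 hk.2]
      exact h12 P hk.1 ((smallCouplings_leavesP_iff_stepInInterval_gOfRecord₁₃Ax θ h v w hC P).1 hsc) hk.2
    · exact hW0 P hk
  have h15 : Dag.B15_main (leavesP { w with C := (datumOfRecord₁₃SepCoPHAx F N θ h).C } P) := B15LeafKnit.b15_main_of_up (U := w.up P) rfl h15leaf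
  -- N13 at the REVISED world (§1), the 𝐑-leaf from the twin (same `up`)
  have h16 : Dag.B16_main (leavesP w P) := b16_main_at_recordVAx_of_rOperation_of_guardedUVRowV F N θ h v w P hC (hnodes₀).2 hγ₁₃ (hUVV P)
  rw [leavesP_revision₁₃Ax_eq_update F N θ h v w P hC] at h16 ⊢
  exact nodes_update_uvBounds_of_nodes11_b15_b16 _ _ (hnodes₀).1 h15 h16

end General

/-! ## §2–§3. ★★★ `N = 2`: rung 1ⱽᵂ's body at the witness; the body from the bills AT θ with N13's bill in the engines' currency -/

section Rung
variable {F : T4Family}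

/-- **★★★ RUNG 1ⱽᵂ's BODY AT THE WITNESS `(θ, h, v, w)`, `λ := λW`** (the matrix of `K1AxV11Defs.NodesAtSomeRecord13PWSVW F` after its four witness binders, verbatim): unity ∧ slots,
admissibility, the slot class (above), the window-guarded thirteen nodes (§2), N08's printed sentence `h08`, and the [IV] pin at the W-pinned world (dag-n12-d `n12Pin_rung1VW_of_rBasicStep_iff`:
the world's `rBasicStep` leaf IS `B15Leaf (W₀ P)`, `upOfRecord₅C_pinW_rBasicStep_iff`, and `W₀` IS the bundle of record on the pinned runs).  GUARDED-ROW EDITION of ✓p813442 §3 (N13 ← `hUVV`).  POINTED, so that the LINE's later rungs can KEEP this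
witness (stub 2ⱽᵂ attaches run rows with `B + r ≤ w.βup` to the SAME `w`).  COMPOSITE: the rung's body GIVEN the children; nothing is discharged.
[cite: Balaban1989LargeFieldII, Thm 1 p.355, (0.1) pp.355–356, p.391; Balaban1988Convergent, Cor. 3 (2.50) p.264; Balaban1985UV3, Thm 1 p.257 + Thm 2 p.272; Balaban1989LargeFieldI, (0.2)–(0.6) p.176, Prop. 1 p.194; Balaban1987RG1, Thm 1 p.259, (2.9) p.266 (bookkeeping)] -/
theorem N24_rung1VW_bodyAt_pointed_of_uvRowV (θ : Stage13HParams F 2) (h : θ.Provisos₁₃SepCoPHAx F 2) (hθ : θ.Admissible F 2)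
    (hU : θ.ZhUnity F 2 ∧ θ.SlotsNondegenerate₁₃Ax F 2) (v : Revision₁₃Ax F 2 θ h)
    (X' : B12.RunParams → PrintedCarriersR) (Y₀ : PrintedCarriers9X) (ζ : ResidZ F 2) (W₀ : B12.RunParams → PrintedCarriers15) (lamW : ResidW F 2) (w : WorldP)
    (hC : w.C = (datumOfRecord₁₃SepCoPHVAx F 2 θ h v).C) (hγ : 0 < w.γ ∧ w.γ ≤ θ.γ) (hL : w.L = (θ.L : ℝ))
    (hup : ∀ P, w.up P = upOfRecord₅CS F 2 ((((((θ.rebindX F 2 X').toStage5₁₃CoPHChi F 2 (chiβOfRecord₁₃Ax F 2 θ.toStage13Params)).pinB10 F 2).pinY F 2 Y₀).pinZ F 2 (Z11OfRecord F 2 ζ)).pinW F 2 W₀) P)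
    (h05S : ∀ P : B12.RunParams,
      (upOfRecord₅CS F 2 ((((((θ.rebindX F 2 X').toStage5₁₃CoPHChi F 2 (chiβOfRecord₁₃Ax F 2 θ.toStage13Params)).pinB10 F 2).pinY F 2 Y₀).pinZ F 2 (Z11OfRecord F 2 ζ)).pinW F 2 W₀) P).b8)
    (h06 : B9LeafX Y₀)
    (h07 : B11Leaf (Z11OfRecord F 2 ζ))
    (h08 : PrintedUV3V 2 θ.L)
    (h09 : ∀ P : B12.RunParams, B12Sec2to5.Lemma4Printed (X' P).F12 (X' P).c12)
    (h09T : ∀ P : B12.RunParams, (leavesP { w with C := (datumOfRecord₁₃SepCoPHAx F 2 θ h).C } P).smallCouplings →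
      (leavesP { w with C := (datumOfRecord₁₃SepCoPHAx F 2 θ h).C } P).smallFieldInductive)
    (h10 : ∀ P : B12.RunParams, B9LeafX Y₀ →
      (B10.Thm1PrintedCompact (((((((θ.rebindX F 2 X').toStage5₁₃CoPHChi F 2 (chiβOfRecord₁₃Ax F 2 θ.toStage13Params)).pinB10 F 2).pinY F 2 Y₀).pinZ F 2 (Z11OfRecord F 2 ζ)).pinW F 2 W₀).res.X P).runs10 ∧
          B10.Thm2Printed (((((((θ.rebindX F 2 X').toStage5₁₃CoPHChi F 2 (chiβOfRecord₁₃Ax F 2 θ.toStage13Params)).pinB10 F 2).pinY F 2 Y₀).pinZ F 2 (Z11OfRecord F 2 ζ)).pinW F 2 W₀).res.X P).runs10) →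
        B11Leaf (Z11OfRecord F 2 ζ) → B12Sec2to5.Lemma4Printed (X' P).F12 (X' P).c12 →
          B13.Lemma1Printed (X' P).S13 (X' P).c13 ∧ B13.Lemma2Printed (X' P).S13 (X' P).c13 ∧ B13.Lemma3Printed (X' P).S13 (X' P).c13)
    (h11 : ∀ P : B12.RunParams, (leavesP { w with C := (datumOfRecord₁₃SepCoPHAx F 2 θ h).C } P).b7 → (leavesP { w with C := (datumOfRecord₁₃SepCoPHAx F 2 θ h).C } P).b8 →
      (leavesP { w with C := (datumOfRecord₁₃SepCoPHAx F 2 θ h).C } P).b9 → (leavesP { w with C := (datumOfRecord₁₃SepCoPHAx F 2 θ h).C } P).b10 →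
      (leavesP { w with C := (datumOfRecord₁₃SepCoPHAx F 2 θ h).C } P).b11 → (leavesP { w with C := (datumOfRecord₁₃SepCoPHAx F 2 θ h).C } P).smallCouplings →
      (leavesP { w with C := (datumOfRecord₁₃SepCoPHAx F 2 θ h).C } P).smallFieldInductive → (leavesP { w with C := (datumOfRecord₁₃SepCoPHAx F 2 θ h).C } P).flowControl →
        ∀ k, k < P.K → SLaw₁₃CoPHChi F 2 θ (chiβOfRecord₁₃Ax F 2 θ.toStage13Params) P k → TLaw₁₃CoPHChi F 2 θ (chiβOfRecord₁₃Ax F 2 θ.toStage13Params) P k)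
    (hR : ∀ (P : B12.RunParams) (k : ℕ), k < P.K → TLaw₁₃CoPHChi F 2 θ (chiβOfRecord₁₃Ax F 2 θ.toStage13Params) P k → SLaw₁₃CoPHChi F 2 θ (chiβOfRecord₁₃Ax F 2 θ.toStage13Params) P (k + 1))
    (hK : ∀ P : B12.RunParams, 1 ≤ P.K → lamW.kSel P < P.K)
    (hW : ∀ P : B12.RunParams, lamW.kSel P < P.K → B15Claim189PinsOfHistory.N0OfRecord₁₃Ax θ.toStage13Params P (lamW.kSel P + 1) ≤ lamW.kSel P + 1 → W₀ P = WOfRecord₁₃Ax F 2 θ.toStage13Params lamW P)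
    (hW0 : ∀ P : B12.RunParams, ¬ (lamW.kSel P < P.K ∧ B15Claim189PinsOfHistory.N0OfRecord₁₃Ax θ.toStage13Params P (lamW.kSel P + 1) ≤ lamW.kSel P + 1) → B15Leaf (W₀ P))
    (h12 : ∀ P : B12.RunParams, lamW.kSel P < P.K → Step.InInterval w.γ P.K (gOfRecord₁₃Ax F 2 θ.toStage13Params P) → B15Claim189PinsOfHistory.N0OfRecord₁₃Ax θ.toStage13Params P (lamW.kSel P + 1) ≤ lamW.kSel P + 1 → B15Leaf (WOfRecord₁₃Ax F 2 θ.toStage13Params lamW P))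
    {γ₁₃ : ℝ} (hγ₁₃ : w.γ ≤ γ₁₃)
    (hUVV : ∀ P : B12.RunParams, (genFlow (betaOfRecord₁₃Ax F 2 θ.toStage13Params) P.g0).InInterval γ₁₃ P.K → ∀ k, k ≤ P.K →
      SLaw₁₃CoPHChi F 2 θ (chiβOfRecord₁₃Ax F 2 θ.toStage13Params) P k → ∀ U : GaugeField (F.P P.K) k (SU 2),
        chiβOfRecord₁₃Ax F 2 θ.toStage13Params P.K (gOfRecord₁₃Ax F 2 θ.toStage13Params P) k U *
              Real.exp (-(1 / (gOfRecord₁₃Ax F 2 θ.toStage13Params P k) ^ 2 * wilsonBGOfRecord F 2 θ.εbg P k U)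
                - w.em (gOfRecord₁₃Ax F 2 θ.toStage13Params P k) * (Fintype.card (Site (F.P P.K) k) : ℝ)) ≤ v.ρ P k U ∧
          v.ρ P k U ≤ Real.exp (w.ep (gOfRecord₁₃Ax F 2 θ.toStage13Params P k) * (Fintype.card (Site (F.P P.K) k) : ℝ))) :
    (θ.ZhUnity F 2 ∧ θ.SlotsNondegenerate₁₃Ax F 2) ∧ θ.Admissible F 2 ∧ RecordSV F θ h v w ∧
      (∀ P : B12.RunParams, (leavesP w P).smallCouplings → Nodes (leavesP w P)) ∧ PrintedUV3V 2 θ.L ∧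
      ∃ lam : ResidW F 2, (∀ P : B12.RunParams, 1 ≤ P.K → lam.kSel P < P.K) ∧
        ∀ P : B12.RunParams, lam.kSel P < P.K → (leavesP w P).smallCouplings →
          B15Claim189PinsOfHistory.N0OfRecord₁₃Ax θ.toStage13Params P (lam.kSel P + 1) ≤ lam.kSel P + 1 → ((leavesP w P).rBasicStep ↔ B15Leaf (WOfRecord₁₃Ax F 2 θ.toStage13Params lam P)) := by
  have hrb : ∀ P : B12.RunParams, (leavesP w P).rBasicStep ↔ B15Leaf (W₀ P) := fun P => by
    show (w.up P).rBasicStep ↔ _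
    rw [hup P]
    exact upOfRecord₅C_pinW_rBasicStep_iff F 2 _ W₀ P
  exact ⟨hU, hθ, N24_recordSV_Ax_of_upS_rebindX_pinB10Y₀ZW₀ θ h hθ v X' Y₀ ζ W₀ w hC hγ hL hup,
    N24_nodesW_at_recordSV_Ax_pointed_of_uvRowV θ h hθ v X' Y₀ ζ W₀ lamW w hC hγ hL hup h05S h06 h07 h08 h09 h09T h10 h11 hR hW hW0 h12 hγ₁₃ hUVV, h08,
    -- v11.3 (R-a′): the [IV] pin at the W-pinned world on the windowed runs WHOSE MEMORY FITS (dag-n12-d `n12Pin_rung1VW_of_rBasicStep_iff` with one more antecedent, inlined)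
    ⟨lamW, hK, fun P hk _ hN => by rw [hrb P, hW P hk hN]⟩⟩

/-- **★★★★ RUNG 1ⱽᵂ's BODY AT THE RUNG's BOUND θ FROM THE PER-NODE BILLS AT θ** — for ONE `F`, ONE rung-0 witness `θ` (re-centred provisos `h`, unity ∧ slots, admissible — K0ᴬ's body) and a
prescribed ceiling letter `βup`, the children's products AT θ (N05 `h05` … N13 `h13`, shapes as in `stub1TextVW_of_bills_atWitnessFamily` below, at one θ) — N13's bill now THE K1ᴬ ENGINE's N13 BINDER VERBATIM (level 0 at every `U`, levels ≥ 1 `dV`-a.e., `SLaw`-guarded; the revision `v` is BUILT here by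
`…N13GuardedUVRowAtRevisionOfAERowsAtRecord13Ax.exists_revision₁₃Ax_guardedUVRowV_of_row0_of_aeRowSucc`, Theorem-1-free) — yield a revision `v` and a world `w` with `w.βup = βup`,
`0 < w.γ` and RUNG 1ⱽᵂ's BODY at `(θ, h, v, w)`: the world S-bound to the χ⋆-four-pin chain of the H-X-pinned parameter (`XPinned₁₃H θ λ₈ λ₁₂ λ₁₃`, [B9] bundle `Y₀`, `Z11OfRecord ζ`, `W₀ :=` the
bundle of record on the pinned runs and a true [IV] leaf elsewhere), window `γ := min θ.γ (min γ₉ (min γ₁₁ (min γ₁₂ γ₁₃)))`, dependence functions `em`, `max ep (−em)`, `β₀ := 1`.  The POINTED form the LINE's later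
rungs consume (stub 2ⱽᵂ re-reads it with `βup := B + r`).  CONDITIONAL; closes nothing; nothing of Bałaban asserted.
[cite: Balaban1989LargeFieldII, Thm 1 p.355, (0.1) pp.355–356, p.387, p.391; Balaban1985RegularSpaces, Thm 2 p.83, Thm 8 (1.146) p.101; Balaban1985BackgroundPropagators, Thm 3.1 p.397; Balaban1985Variational, Thm 1 p.279; Balaban1985UV3, Thm 1 p.257, Thm 2 p.272; Balaban1987RG1, Lemma 4 p.280, Thm 1 p.259, (2.9) p.266; Balaban1988RG2Cluster, Lemmas 1–3 pp.9–20; Balaban1988Convergent, Thm 2 p.263, (2.18) p.257, Cor. 3 (2.50) p.264; Balaban1989LargeFieldI, (0.2)–(0.6) p.176, Prop. 1 p.194 (bookkeeping over the cell's DAG)] -/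
theorem N24_rung1VW_bodyAt_of_bills_at_aeRow (F : T4Family) (θ : Stage13HParams F 2) (h : θ.Provisos₁₃SepCoPHAx F 2) (hU : θ.ZhUnity F 2 ∧ θ.SlotsNondegenerate₁₃Ax F 2) (hθ : θ.Admissible F 2)
    (h05 : ∃ lam8 : ResidB8 θ.toStage3Params, B8LeafOfRecordSubBH θ.toStage3Params lam8)
    (h06 : ∃ Y₀ : PrintedCarriers9X, B9LeafX Y₀)
    (h07 : ∃ ζ : ResidZ F 2, B11Leaf (Z11OfRecord F 2 ζ))
    (h08 : PrintedUV3V 2 θ.L)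
    (h09 : ∃ lam12 : ResidB12 F 2 θ.τ9.M, ∀ P : B12.RunParams, B12Sec2to5.Lemma4Printed (F12OfRecord₁₂ F 2 θ.toStage12Params lam12 P) (lam12 P).consts)
    (h09T : ∃ γ₉ : ℝ, 0 < γ₉ ∧ ∀ w : WorldP, w.C = (datumOfRecord₁₃SepCoPHAx F 2 θ h).C → w.γ ≤ γ₉ →
        ∀ P : B12.RunParams, (leavesP w P).smallCouplings → (leavesP w P).smallFieldInductive)
    (h10 : ∃ lam13 : B12.RunParams → ResidB13 θ.toStage3Params, ∀ P : B12.RunParams, B13LeafOfRecord θ.toStage3Params (lam13 P))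
    (h11 : ∀ βup β₀ : ℝ, ∃ γ₁₁ : ℝ, 0 < γ₁₁ ∧ ∀ w : WorldP, w.C = (datumOfRecord₁₃SepCoPHAx F 2 θ h).C → w.βup = βup → w.β₀ = β₀ → w.γ ≤ γ₁₁ →
        ∀ P : B12.RunParams, (leavesP w P).b7 → (leavesP w P).b8 → (leavesP w P).b9 → (leavesP w P).b10 → (leavesP w P).b11 →
          (leavesP w P).smallCouplings → (leavesP w P).smallFieldInductive → (leavesP w P).flowControl →
            ∀ k, k < P.K → SLaw₁₃CoPHChi F 2 θ (chiβOfRecord₁₃Ax F 2 θ.toStage13Params) P k → TLaw₁₃CoPHChi F 2 θ (chiβOfRecord₁₃Ax F 2 θ.toStage13Params) P k)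
    (hR : ∀ (P : B12.RunParams) (k : ℕ), k < P.K → TLaw₁₃CoPHChi F 2 θ (chiβOfRecord₁₃Ax F 2 θ.toStage13Params) P k → SLaw₁₃CoPHChi F 2 θ (chiβOfRecord₁₃Ax F 2 θ.toStage13Params) P (k + 1))
    (h12 : ∃ (lamW : ResidW F 2) (γ₁₂ : ℝ), 0 < γ₁₂ ∧ (∀ P : B12.RunParams, 1 ≤ P.K → lamW.kSel P < P.K) ∧
        ∀ P : B12.RunParams, lamW.kSel P < P.K → Step.InInterval γ₁₂ P.K (gOfRecord₁₃Ax F 2 θ.toStage13Params P) →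
        B15Claim189PinsOfHistory.N0OfRecord₁₃Ax θ.toStage13Params P (lamW.kSel P + 1) ≤ lamW.kSel P + 1 → B15Leaf (WOfRecord₁₃Ax F 2 θ.toStage13Params lamW P))
    (h13 : ∃ γ₁₃ : ℝ, 0 < γ₁₃ ∧ ∃ em ep : ℝ → ℝ,
        (∀ P : B12.RunParams, ((datumOfRecord₁₃SepCoPHAx F 2 θ h).C P).flow.InInterval γ₁₃ P.K → SLaw₁₃CoPHChi F 2 θ (chiβOfRecord₁₃Ax F 2 θ.toStage13Params) P 0 →
      ∀ U : GaugeField (F.P P.K) 0 (SU 2),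
        chiβOfRecord₁₃Ax F 2 θ.toStage13Params P.K (gOfRecord₁₃Ax F 2 θ.toStage13Params P) 0 U *
              Real.exp (-(1 / (gOfRecord₁₃Ax F 2 θ.toStage13Params P 0) ^ 2 * wilsonBGOfRecord F 2 θ.εbg P 0 U)
                - em (gOfRecord₁₃Ax F 2 θ.toStage13Params P 0) * (Fintype.card (Site (F.P P.K) 0) : ℝ)) ≤ densOfRecord₁₃Chi F 2 θ.toStage13Params (chiβOfRecord₁₃Ax F 2 θ.toStage13Params) P 0 U ∧
          densOfRecord₁₃Chi F 2 θ.toStage13Params (chiβOfRecord₁₃Ax F 2 θ.toStage13Params) P 0 U ≤ Real.exp (ep (gOfRecord₁₃Ax F 2 θ.toStage13Params P 0) * (Fintype.card (Site (F.P P.K) 0) : ℝ))) ∧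
        (∀ P : B12.RunParams, ((datumOfRecord₁₃SepCoPHAx F 2 θ h).C P).flow.InInterval γ₁₃ P.K → ∀ k, k + 1 ≤ P.K → SLaw₁₃CoPHChi F 2 θ (chiβOfRecord₁₃Ax F 2 θ.toStage13Params) P (k + 1) →
      ∀ᵐ U ∂(fieldMeasure (F.P P.K) (k + 1) (SU 2)),
        chiβOfRecord₁₃Ax F 2 θ.toStage13Params P.K (gOfRecord₁₃Ax F 2 θ.toStage13Params P) (k + 1) U *
              Real.exp (-(1 / (gOfRecord₁₃Ax F 2 θ.toStage13Params P (k + 1)) ^ 2 * wilsonBGOfRecord F 2 θ.εbg P (k + 1) U)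
                - em (gOfRecord₁₃Ax F 2 θ.toStage13Params P (k + 1)) * (Fintype.card (Site (F.P P.K) (k + 1)) : ℝ)) ≤ densOfRecord₁₃Chi F 2 θ.toStage13Params (chiβOfRecord₁₃Ax F 2 θ.toStage13Params) P (k + 1) U ∧
          densOfRecord₁₃Chi F 2 θ.toStage13Params (chiβOfRecord₁₃Ax F 2 θ.toStage13Params) P (k + 1) U ≤ Real.exp (ep (gOfRecord₁₃Ax F 2 θ.toStage13Params P (k + 1)) * (Fintype.card (Site (F.P P.K) (k + 1)) : ℝ))))
    (βup : ℝ) :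
    ∃ (v : Revision₁₃Ax F 2 θ h) (w : WorldP), w.βup = βup ∧ 0 < w.γ ∧
      ((θ.ZhUnity F 2 ∧ θ.SlotsNondegenerate₁₃Ax F 2) ∧ θ.Admissible F 2 ∧ RecordSV F θ h v w ∧
        (∀ P : B12.RunParams, (leavesP w P).smallCouplings → Nodes (leavesP w P)) ∧ PrintedUV3V 2 θ.L ∧
        ∃ lam : ResidW F 2, (∀ P : B12.RunParams, 1 ≤ P.K → lam.kSel P < P.K) ∧
          ∀ P : B12.RunParams, lam.kSel P < P.K → (leavesP w P).smallCouplings →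
          B15Claim189PinsOfHistory.N0OfRecord₁₃Ax θ.toStage13Params P (lam.kSel P + 1) ≤ lam.kSel P + 1 → ((leavesP w P).rBasicStep ↔ B15Leaf (WOfRecord₁₃Ax F 2 θ.toStage13Params lam P))) := by
  obtain ⟨lam8, h05⟩ := h05
  obtain ⟨Y₀, h06⟩ := h06
  obtain ⟨ζ, h07⟩ := h07
  obtain ⟨lam12, h09⟩ := h09
  obtain ⟨γ₉, hγ₉, h09T⟩ := h09T
  obtain ⟨lam13, h10⟩ := h10
  obtain ⟨γ₁₁, hγ₁₁, h11⟩ := h11 βup 1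
  obtain ⟨lamW, γ₁₂, hγ₁₂, hK, h12⟩ := h12
  obtain ⟨γ₁₃, hγ₁₃, em, ep₀, hrow0, hrow⟩ := h13
  obtain ⟨v, hUVV⟩ := exists_revision₁₃Ax_guardedUVRowV_of_row0_of_aeRowSucc F 2 θ h hrow0 hrow
  -- the world's upper dependence function: the larger of print's `e₊` and `−e₋` (the barrier the re-chosen densities take on the null sets)
  set ep : ℝ → ℝ := fun g => max (ep₀ g) (-(em g)) with hep_def
  have hγ₀ : 0 < θ.γ := hθ.toStage9.gamma_pos
  have hL1 : (1 : ℝ) < (θ.toStage13Params.L : ℝ) := by exact_mod_cast θ.toStage13Params.hL.2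
  set γw : ℝ := min θ.γ (min γ₉ (min γ₁₁ (min γ₁₂ γ₁₃))) with hγw_def
  have hγw0 : 0 < γw := lt_min hγ₀ (lt_min hγ₉ (lt_min hγ₁₁ (lt_min hγ₁₂ hγ₁₃)))
  have hγwγ : γw ≤ θ.γ := min_le_left _ _
  have hγw9 : γw ≤ γ₉ := (min_le_right _ _).trans (min_le_left _ _)
  have hγw11 : γw ≤ γ₁₁ := (min_le_right _ _).trans ((min_le_right _ _).trans (min_le_left _ _))
  have hγw12 : γw ≤ γ₁₂ := (min_le_right _ _).trans ((min_le_right _ _).trans ((min_le_right _ _).trans (min_le_left _ _)))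
  have hγw13 : γw ≤ γ₁₃ := (min_le_right _ _).trans ((min_le_right _ _).trans ((min_le_right _ _).trans (min_le_right _ _)))
  -- the carriers: the H-X-pin of the three groups of record, the [B9] bundle, the Z-layer, the W-bundle of record on the pinned runs
  let X' : B12.RunParams → PrintedCarriersR := XPinned₁₃H F 2 θ.toStage13Params lam8 lam12 lam13
  let W₀ : B12.RunParams → PrintedCarriers15 := fun P =>
    if lamW.kSel P < P.K ∧ B15Claim189PinsOfHistory.N0OfRecord₁₃Ax θ.toStage13Params P (lamW.kSel P + 1) ≤ lamW.kSel P + 1 then WOfRecord₁₃Ax F 2 θ.toStage13Params lamW P else (exists_printedCarriers15_b15Leaf (F.P P.K)).choose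
  have hW : ∀ P : B12.RunParams, lamW.kSel P < P.K → B15Claim189PinsOfHistory.N0OfRecord₁₃Ax θ.toStage13Params P (lamW.kSel P + 1) ≤ lamW.kSel P + 1 → W₀ P = WOfRecord₁₃Ax F 2 θ.toStage13Params lamW P := fun P hk hN => if_pos ⟨hk, hN⟩
  have hW0 : ∀ P : B12.RunParams, ¬ (lamW.kSel P < P.K ∧ B15Claim189PinsOfHistory.N0OfRecord₁₃Ax θ.toStage13Params P (lamW.kSel P + 1) ≤ lamW.kSel P + 1) → B15Leaf (W₀ P) := fun P hk => by
    show B15Leaf (if lamW.kSel P < P.K ∧ B15Claim189PinsOfHistory.N0OfRecord₁₃Ax θ.toStage13Params P (lamW.kSel P + 1) ≤ lamW.kSel P + 1 then WOfRecord₁₃Ax F 2 θ.toStage13Params lamW P else (exists_printedCarriers15_b15Leaf (F.P P.K)).choose)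
    rw [if_neg hk]
    exact (exists_printedCarriers15_b15Leaf (F.P P.K)).choose_spec
  -- the world: S-bound to the χ⋆-four-pin chain, bound to the REVISED re-centred datum, N13's dependence functions, the shrunk window
  let w : WorldP :=
    { C := (datumOfRecord₁₃SepCoPHVAx F 2 θ h v).C
      γ := γw, em := em, ep := ep, βup := βup, β₀ := 1, β₀_pos := one_pos, b := 1, b_pos := one_pos
      L := (θ.toStage13Params.L : ℝ), one_lt_L := hL1, gR := 0
      up := fun P => upOfRecord₅CS F 2 ((((((θ.rebindX F 2 X').toStage5₁₃CoPHChi F 2 (chiβOfRecord₁₃Ax F 2 θ.toStage13Params)).pinB10 F 2).pinY F 2 Y₀).pinZ F 2 (Z11OfRecord F 2 ζ)).pinW F 2 W₀) P }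
  have hC : w.C = (datumOfRecord₁₃SepCoPHVAx F 2 θ h v).C := rfl
  have hC₀ : ({ w with C := (datumOfRecord₁₃SepCoPHAx F 2 θ h).C } : WorldP).C = (datumOfRecord₁₃SepCoPHAx F 2 θ h).C := rfl
  refine ⟨v, w, rfl, hγw0, N24_rung1VW_bodyAt_pointed_of_uvRowV θ h hθ hU v X' Y₀ ζ W₀ lamW w hC ⟨hγw0, hγwγ⟩ rfl (fun _ => rfl)
    (fun P => (socket05S_chain_pinX3H_iff_Ax θ lam8 lam12 lam13 Y₀ ζ W₀ P).2 h05) h06 h07 h08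
    (fun P => (socket09_XPinned₁₃H_iff θ lam8 lam12 lam13 P).2 (h09 P)) (h09T _ hC₀ hγw9)
    (fun P _ _ _ _ => (socket10_XPinned₁₃H_iff θ lam8 lam12 lam13 P).2 (h10 P)) (h11 _ hC₀ rfl rfl hγw11) hR hK hW hW0
    (fun P hk hI hN => h12 P hk (fun k hkk => ⟨(hI k hkk).1, (hI k hkk).2.trans hγw12⟩) hN) hγw13 (fun P hP => hUVV P hP)⟩

end Rung

/-! ## §4. ★★★★ `stub_nodes13PWSVW`'s SIGNATURE from the bills at a witness family, N13 in the engines' currency (Theses-free) -/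

/-- **★★★★ `stub_nodes13PWSVW`'s TEXT FROM THE PER-NODE BILLS AT A WITNESS FAMILY** (the engine's §3 shape, ✓p810415: a family `Θ F i` of rung-0 tuples — re-centred provisos `hP`, unity ∧
slots `hU`, admissible `hθ` — inhabited whenever rung 0 holds at `F` (`hK0`); every bill is read AT THE FAMILY's MEMBERS, i.e. at the θ the rung will bind — dag-lead g41 GATE v1.273 (c)).
The children hand back, at each `Θ F i`: N05 a residual [B8] layer carrying the REPAIRED SURVIVING SLOT `B8LeafOfRecordSubBH θ₃ λ₈` (`h05`); N06 a [B9] bundle with its leaf (`h06`); N07 a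
residual Z-layer with the [B11] leaf at `Z11OfRecord ζ` (`h07`); N08 print's [B10] sentence `PrintedUV3V 2 θ.L` (`h08`); N09 a [B12] frame of record with Lemma 4 (`h09`) and the Theorem-3
member at every world on the re-centred datum below a radius (`h09T`); N10 a [B13] group of record with its leaf (`h10`); N11 (S1ᵀ) at every world on the re-centred datum with given
`βup ∕ β₀` below a radius (`h11`); N13's (R₁₃) laws `hR`; N12 a residual W-layer pinned at a genuine step (`kSel P < P.K` once `1 ≤ P.K`) with [IV]'s basic step at the RE-CENTRED BUNDLE OF
RECORD `WOfRecord₁₃Ax θ λ P` on the runs inside a coupling window (`h12`; dag-n12-d's currency — PAYABLE ONLY AT MEMBERS WHOSE `p–p′` SELECTOR IS THE LIVE ONE, dag-n12-d I.22983: every N12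
road concludes at `θ.toStage13Params.liveRepin₁₃Ax`; the K1ᴬ face's witness `theta13OfThm1CCMWZBAx …` IS on the re-pin, `rfl`); N13 THE K1ᴬ ENGINE's N13 BINDER VERBATIM — (2.50) in the engines' letters below a radius, at EVERY field at level 0 and `dV`-a.e. at levels ≥ 1, `SLaw`-guarded (`h13`; the revision is built
inside, Theorem-1-free) ⟹ the registered stub's SIGNATURE `∀ F, Inhabited13 F → NodesAtSomeRecord13PWSVW F` (= `K1AxV11StubTexts.Stub1TextVW` by `δ`; read at that NAME in the sequel, which imports the route cone), the rung binding `θ := Θ F i` and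
the revision ∕ world of `N24_rung1VW_bodyAt_of_bills_at_aeRow` (`βup` free, `β₀ := 1`).  WHICH CHILD BLOCKS `stub_nodes13PWSVW` = this hypothesis list, BY NAME, at the family.  CONDITIONAL
(audit `proof.conditional` displays the bills); closes nothing; nothing of Bałaban asserted.
[cite: Balaban1989LargeFieldII, Thm 1 p.355, (0.1) pp.355–356, p.387, p.391; Balaban1985RegularSpaces, Thm 2 p.83, Thm 8 (1.146) p.101; Balaban1985BackgroundPropagators, Thm 3.1 p.397; Balaban1985Variational, Thm 1 p.279; Balaban1985UV3, Thm 1 p.257, Thm 2 p.272; Balaban1987RG1, Lemma 4 p.280, Thm 1 p.259, Thm 3 p.264, (2.9) p.266; Balaban1988RG2Cluster, Lemmas 1–3 pp.9–20; Balaban1988Convergent, Thm 2 p.263, (2.18) p.257, (3.22) p.269, Cor. 3 (2.50) p.264; Balaban1989LargeFieldI, (0.2)–(0.6) p.176, Prop. 1 p.194 (bookkeeping over the cell's DAG)] -/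
theorem stub1TextVW_of_bills_atWitnessFamily_aeRow (ι : T4Family → Type) (Θ : ∀ F : T4Family, ι F → Stage13HParams F 2) (hK0 : ∀ F : T4Family, Inhabited13 F → Nonempty (ι F))
    (hP : ∀ (F : T4Family) (i : ι F), (Θ F i).Provisos₁₃SepCoPHAx F 2) (hU : ∀ (F : T4Family) (i : ι F), (Θ F i).ZhUnity F 2 ∧ (Θ F i).SlotsNondegenerate₁₃Ax F 2)
    (hθ : ∀ (F : T4Family) (i : ι F), (Θ F i).Admissible F 2)
    (h05 : ∀ (F : T4Family) (i : ι F), ∃ lam8 : ResidB8 (Θ F i).toStage3Params, B8LeafOfRecordSubBH (Θ F i).toStage3Params lam8)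
    (h06 : ∀ (F : T4Family) (_ : ι F), ∃ Y₀ : PrintedCarriers9X, B9LeafX Y₀)
    (h07 : ∀ (F : T4Family) (_ : ι F), ∃ ζ : ResidZ F 2, B11Leaf (Z11OfRecord F 2 ζ))
    (h08 : ∀ (F : T4Family) (i : ι F), PrintedUV3V 2 (Θ F i).L)
    (h09 : ∀ (F : T4Family) (i : ι F), ∃ lam12 : ResidB12 F 2 (Θ F i).τ9.M,
      ∀ P : B12.RunParams, B12Sec2to5.Lemma4Printed (F12OfRecord₁₂ F 2 (Θ F i).toStage12Params lam12 P) (lam12 P).consts)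
    (h09T : ∀ (F : T4Family) (i : ι F), ∃ γ₉ : ℝ, 0 < γ₉ ∧ ∀ w : WorldP, w.C = (datumOfRecord₁₃SepCoPHAx F 2 (Θ F i) (hP F i)).C → w.γ ≤ γ₉ →
      ∀ P : B12.RunParams, (leavesP w P).smallCouplings → (leavesP w P).smallFieldInductive)
    (h10 : ∀ (F : T4Family) (i : ι F), ∃ lam13 : B12.RunParams → ResidB13 (Θ F i).toStage3Params, ∀ P : B12.RunParams, B13LeafOfRecord (Θ F i).toStage3Params (lam13 P))
    (h11 : ∀ (F : T4Family) (i : ι F), ∀ βup β₀ : ℝ, ∃ γ₁₁ : ℝ, 0 < γ₁₁ ∧ ∀ w : WorldP, w.C = (datumOfRecord₁₃SepCoPHAx F 2 (Θ F i) (hP F i)).C → w.βup = βup → w.β₀ = β₀ → w.γ ≤ γ₁₁ →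
      ∀ P : B12.RunParams, (leavesP w P).b7 → (leavesP w P).b8 → (leavesP w P).b9 → (leavesP w P).b10 → (leavesP w P).b11 →
        (leavesP w P).smallCouplings → (leavesP w P).smallFieldInductive → (leavesP w P).flowControl →
          ∀ k, k < P.K → SLaw₁₃CoPHChi F 2 (Θ F i) (chiβOfRecord₁₃Ax F 2 (Θ F i).toStage13Params) P k → TLaw₁₃CoPHChi F 2 (Θ F i) (chiβOfRecord₁₃Ax F 2 (Θ F i).toStage13Params) P k)
    (hR : ∀ (F : T4Family) (i : ι F) (P : B12.RunParams) (k : ℕ), k < P.K →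
      TLaw₁₃CoPHChi F 2 (Θ F i) (chiβOfRecord₁₃Ax F 2 (Θ F i).toStage13Params) P k → SLaw₁₃CoPHChi F 2 (Θ F i) (chiβOfRecord₁₃Ax F 2 (Θ F i).toStage13Params) P (k + 1))
    (h12 : ∀ (F : T4Family) (i : ι F), ∃ (lamW : ResidW F 2) (γ₁₂ : ℝ), 0 < γ₁₂ ∧ (∀ P : B12.RunParams, 1 ≤ P.K → lamW.kSel P < P.K) ∧
      ∀ P : B12.RunParams, lamW.kSel P < P.K → Step.InInterval γ₁₂ P.K (gOfRecord₁₃Ax F 2 (Θ F i).toStage13Params P) →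
        B15Claim189PinsOfHistory.N0OfRecord₁₃Ax (Θ F i).toStage13Params P (lamW.kSel P + 1) ≤ lamW.kSel P + 1 → B15Leaf (WOfRecord₁₃Ax F 2 (Θ F i).toStage13Params lamW P))
    (h13 : ∀ (F : T4Family) (i : ι F), ∃ γ₁₃ : ℝ, 0 < γ₁₃ ∧ ∃ em ep : ℝ → ℝ,
        (∀ P : B12.RunParams, ((datumOfRecord₁₃SepCoPHAx F 2 (Θ F i) (hP F i)).C P).flow.InInterval γ₁₃ P.K → SLaw₁₃CoPHChi F 2 (Θ F i) (chiβOfRecord₁₃Ax F 2 (Θ F i).toStage13Params) P 0 →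
      ∀ U : GaugeField (F.P P.K) 0 (SU 2),
        chiβOfRecord₁₃Ax F 2 (Θ F i).toStage13Params P.K (gOfRecord₁₃Ax F 2 (Θ F i).toStage13Params P) 0 U *
              Real.exp (-(1 / (gOfRecord₁₃Ax F 2 (Θ F i).toStage13Params P 0) ^ 2 * wilsonBGOfRecord F 2 (Θ F i).εbg P 0 U)
                - em (gOfRecord₁₃Ax F 2 (Θ F i).toStage13Params P 0) * (Fintype.card (Site (F.P P.K) 0) : ℝ)) ≤ densOfRecord₁₃Chi F 2 (Θ F i).toStage13Params (chiβOfRecord₁₃Ax F 2 (Θ F i).toStage13Params) P 0 U ∧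
          densOfRecord₁₃Chi F 2 (Θ F i).toStage13Params (chiβOfRecord₁₃Ax F 2 (Θ F i).toStage13Params) P 0 U ≤ Real.exp (ep (gOfRecord₁₃Ax F 2 (Θ F i).toStage13Params P 0) * (Fintype.card (Site (F.P P.K) 0) : ℝ))) ∧
        (∀ P : B12.RunParams, ((datumOfRecord₁₃SepCoPHAx F 2 (Θ F i) (hP F i)).C P).flow.InInterval γ₁₃ P.K → ∀ k, k + 1 ≤ P.K → SLaw₁₃CoPHChi F 2 (Θ F i) (chiβOfRecord₁₃Ax F 2 (Θ F i).toStage13Params) P (k + 1) →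
      ∀ᵐ U ∂(fieldMeasure (F.P P.K) (k + 1) (SU 2)),
        chiβOfRecord₁₃Ax F 2 (Θ F i).toStage13Params P.K (gOfRecord₁₃Ax F 2 (Θ F i).toStage13Params P) (k + 1) U *
              Real.exp (-(1 / (gOfRecord₁₃Ax F 2 (Θ F i).toStage13Params P (k + 1)) ^ 2 * wilsonBGOfRecord F 2 (Θ F i).εbg P (k + 1) U)
                - em (gOfRecord₁₃Ax F 2 (Θ F i).toStage13Params P (k + 1)) * (Fintype.card (Site (F.P P.K) (k + 1)) : ℝ)) ≤ densOfRecord₁₃Chi F 2 (Θ F i).toStage13Params (chiβOfRecord₁₃Ax F 2 (Θ F i).toStage13Params) P (k + 1) U ∧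
          densOfRecord₁₃Chi F 2 (Θ F i).toStage13Params (chiβOfRecord₁₃Ax F 2 (Θ F i).toStage13Params) P (k + 1) U ≤ Real.exp (ep (gOfRecord₁₃Ax F 2 (Θ F i).toStage13Params P (k + 1)) * (Fintype.card (Site (F.P P.K) (k + 1)) : ℝ))))
    (βup : ℝ) :
    ∀ F : T4Family, Inhabited13 F → NodesAtSomeRecord13PWSVW F := by
  intro F hF
  obtain ⟨i⟩ := hK0 F hF
  obtain ⟨v, w, -, -, hbody⟩ := N24_rung1VW_bodyAt_of_bills_at_aeRow F (Θ F i) (hP F i) (hU F i) (hθ F i) (h05 F i) (h06 F i) (h07 F i) (h08 F i) (h09 F i)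
    (h09T F i) (h10 F i) (h11 F i) (hR F i) (h12 F i) (h13 F i) βup
  exact ⟨Θ F i, hP F i, v, w, hbody⟩

end Summit.QuantumFields.YangMills.BalabanUVNodes.N24Stub1VWShareK1AxV113AERow

end
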